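import Summits.BirchSwinnertonDyer.BirchSwinnertonDyer.Theorems.CMKolyvaginAtInertTwoInfResIndexTwoAtTwo
import Literature.NumberTheory.EllipticCurves.TorsionLocalKernelRestrictionProofs
import HarnessLib

/-!
# Route `CMKolyvaginAtInertTwo`, crux `CMKolyvaginExactAtInertTwo` (stmt-BirchSwinnertonDyer-24277):
# T2 local input, step 2 — EQUALITY of the strict local kernels `ker(H¹(K,E[n]) → H¹(E,·))` and
# `ker(H¹(K,E[n]) → H¹(E',·))` along a tower `E → E'` whose restriction `H¹(E,·) → H¹(E',·)` is
# injective; in particular across an index-two step (the engine of `…InfResIndexTwoAtTwo`)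

Seat `bsd-line-cmk2-p1` g15 (cell `bsd-print-cf2`); helper (`--supports stmt-BirchSwinnertonDyer-24277`).
THEOREMS ONLY: no definition, no named fact, no `sorry`; no item is closed; BSD is not proved by this.

KERNEL-STATUS §14.3: on the `ℚ`-carrier (path β) of the `p = 2` pair telescope the local condition
`Sd.A ℓ = f⁻¹(pairA ℓ)` at an inert Kolyvagin prime `ℓ` (`λ ∣ ℓ` the prime of `K`) is the equality
`W.torsionLocalKer ℚ_ℓ 2^M = W.torsionLocalKer K_λ 2^M` of STRICT local kernels of `H¹(ℚ, E[2^M])`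
(then ty2's `mem_torsionLocalKer_iff_resTorsion_mem` moves the right side to `H¹(K, E_K[2^M])`).
`≤` is ty2's `torsionLocalKer_le_of_tower`. This file proves `≥` — hence `=` — from the injectivity
of the local restriction `H¹(Γ_E, E(K̄_E)[n]) → H¹(Γ_{E'}, E(K̄_{E'})[n])` along the tower pair
`(res_{ι₂} : Γ_{E'} → Γ_E, ψ₂ = ι₂ on points)` (`resKer … = ⊥`), by the factorisation
`res_{E'} = (res along ι₂) ∘ res_E` (`resGalOfEmb_comp_tower`, `resH1Hom_resH1Hom`, independence
of the embedding `torsionLocalKer_eq_resKer_of_emb`) — and then feeds the index-two engine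
`KolyvaginInfResTwo.resKer_eq_bot_of_index_two`: the equality holds as soon as the image of
`Γ_{E'} → Γ_E` contains an open normal `N` with `Γ_E = N ∪ τN`, `τ² ∈ N`, `ψ₂` bijective (all
`n`-torsion already over `K̄_E`, automatic) and `m + τm = 0 ⟹ m = τx − x` on `E(K̄_E)[n]^N`
(the regular `C₂`-module at a Kolyvagin prime, `exists_smul_sub_eq_of_regular`).

* `torsionLocalKer_eq_of_resKer_tower_eq_bot` — `ker res_E = ker res_{E'}` in `H¹(K, E[n])` if the
  tower restriction `H¹(E, E(K̄_E)[n]) → H¹(E', E(K̄_{E'})[n])` is injective;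
* `torsionLocalKer_eq_of_index_two` — the same from the index-two data (`N`, `τ`, solvability).

What remains for T2 (β) after this: exhibit, for `E = ℚ_ℓ`, `E' = K_λ` (`adicCompletion`s, the
algebra structure `adicCompletionMap`), the open normal index-two `N ≤ im(Γ_{K_λ} → Γ_{ℚ_ℓ})` with
a Frobenius `τ` acting on `E[2^M]` as complex conjugation does (depth-`(M+1)` Kolyvagin prime).
References: Serre, *Galois Cohomology* I.§2.4, I.§5.8, II.§1.1; Gross 1991 §§8–9; McCallum 1991 §3.
-/

-- single-conjunct summit: `Summit.BirchSwinnertonDyer.BirchSwinnertonDyer.…` repeats the name by design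
set_option linter.dupNamespace false
set_option autoImplicit false

noncomputable section

open scoped Classical

universe u

open Literature.NumberTheory.EllipticCurves Literature.NumberTheory.GaloisRepresentations WeierstrassCurve

namespace Summit.BirchSwinnertonDyer.BirchSwinnertonDyer.Theorems.KolyvaginInfResTwo

section Tower

variable {K : Type u} [Field K] (W : WeierstrassCurve K)
variable {E : Type u} [Field E] [Algebra K E]
variable {E' : Type u} [Field E'] [Algebra K E'] [Algebra E E'] [IsScalarTower K E E']

/-- **Strict local kernels along a tower with injective local restriction are EQUAL.** For
`K`-fields `E → E'`, an `E`-embedding `ι₂ : K̄_E → K̄_{E'}`, and the map `ψ₂` it induces on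
`n`-torsion points (characterised by its values, `hψ₂val`), compatible with `res_{ι₂} : Γ_{E'} → Γ_E`:
if `ker (H¹(Γ_E, E(K̄_E)[n]) → H¹(Γ_{E'}, E(K̄_{E'})[n])) = 0` along `(res_{ι₂}, ψ₂)` then
`torsionLocalKer W E n = torsionLocalKer W E' n`. `≤`: `torsionLocalKer_le_of_tower`; `≥`: the
restriction to `Γ_{E'}` of a class of `H¹(K, E[n])` is the image under `(res_{ι₂}, ψ₂)` of its
restriction to `Γ_E` (`resGalOfEmb_comp_tower`, `resH1Hom_resH1Hom`; the kernel at `E'` may be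
computed along `ι₂ ∘ ι_E`, `torsionLocalKer_eq_resKer_of_emb`).
[cite: SerreGaloisCohomology1997, I.§2.4 and II.§1.1] [cite: MilneADT2006, I.§6] -/
theorem torsionLocalKer_eq_of_resKer_tower_eq_bot (n : ℤ)
    (ι₂ : AlgebraicClosure E →ₐ[E] AlgebraicClosure E')
    (ψ₂ : AddSubgroup.torsionBy (localPoints W E) n →+ AddSubgroup.torsionBy (localPoints W E') n)
    (hψ₂val : ∀ Q : AddSubgroup.torsionBy (localPoints W E) n,
      (ψ₂ Q : localPoints W E') = pointsMapTower W ι₂ (Q : localPoints W E))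
    (hψ₂ : ∀ (x : Field.absoluteGaloisGroup E') (Q : AddSubgroup.torsionBy (localPoints W E) n),
      ψ₂ (resGalOfEmb (K := E) ι₂ x • Q) = x • ψ₂ Q)
    (hinj : resKer (resGalOfEmb (K := E) ι₂) ψ₂ hψ₂ = ⊥) :
    W.torsionLocalKer E n = W.torsionLocalKer E' n := by
  refine le_antisymm (torsionLocalKer_le_of_tower W n) fun c hc ↦ ?_
  let ι₁ : AlgebraicClosure K →ₐ[K] AlgebraicClosure E := closureEmb (K := K) E
  -- the composite pair `Γ_{E'} → Γ_E → Γ_K` is the pair along `ι₂ ∘ ι₁`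
  let ψ : geomTorsion W n →+ AddSubgroup.torsionBy (localPoints W E') n :=
    ψ₂.comp (torsionPointsMap W E n)
  have hψval : ∀ P : geomTorsion W n,
      (ψ P : localPoints W E') = pointsMapOfEmb W ((ι₂.restrictScalars K).comp ι₁) P := by
    intro P
    rw [pointsMapOfEmb_comp_tower]
    change (ψ₂ (torsionPointsMap W E n P) : localPoints W E') = _
    rw [hψ₂val]
    rfl
  have hcomp : ∀ (x : Field.absoluteGaloisGroup E') (P : geomTorsion W n),
      ψ (resGalOfEmb ((ι₂.restrictScalars K).comp ι₁) x • P) = x • ψ P := by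
    intro x P
    rw [resGalOfEmb_comp_tower]
    change ψ₂ (torsionPointsMap W E n (resGal (K := K) E (resGalOfEmb (K := E) ι₂ x) • P)) = _
    rw [torsionPointsMap_smul, hψ₂]
    rfl
  rw [← torsionLocalKer_eq_resKer_of_emb W ((ι₂.restrictScalars K).comp ι₁) n ψ hψval hcomp,
    resKer_eq_ker, AddMonoidHom.mem_ker] at hc
  have e : resH1Hom (resGalOfEmb ((ι₂.restrictScalars K).comp ι₁)) ψ hcomp =
      resH1Hom ((resGal (K := K) E).comp (resGalOfEmb (K := E) ι₂)) (ψ₂.comp (torsionPointsMap W E n))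
        (fun x m ↦ by
          change ψ₂ (torsionPointsMap W E n (resGal (K := K) E (resGalOfEmb (K := E) ι₂ x) • m)) =
            x • ψ₂ (torsionPointsMap W E n m)
          rw [torsionPointsMap_smul, hψ₂]) :=
    resH1Hom_congr (resGalOfEmb_comp_tower ι₁ ι₂) rfl _ _
  rw [e, ← resH1Hom_resH1Hom (resGal (K := K) E) (torsionPointsMap W E n) (torsionPointsMap_smul W E n)
    (resGalOfEmb (K := E) ι₂) ψ₂ hψ₂] at hc
  -- so `res_E c` lies in the (trivial) kernel of the tower restriction
  have hmem : resH1Hom (resGal (K := K) E) (torsionPointsMap W E n) (torsionPointsMap_smul W E n) c ∈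
      resKer (resGalOfEmb (K := E) ι₂) ψ₂ hψ₂ := by
    rw [resKer_eq_ker, AddMonoidHom.mem_ker]
    exact hc
  rw [hinj, AddSubgroup.mem_bot] at hmem
  exact hmem

/-- **Strict local kernels are equal across an index-two step.** In the situation of
`torsionLocalKer_eq_of_resKer_tower_eq_bot`, suppose `ψ₂` is bijective (every `n`-torsion point of
`E(K̄_{E'})` comes from `E(K̄_E)`), and the image of `Γ_{E'} → Γ_E` contains an open normal subgroup
`N` with `Γ_E = N ∪ τN`, `τ² ∈ N`, such that on the `N`-invariants of `E(K̄_E)[n]` every `m` with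
`m + τm = 0` is `τx − x` for an `N`-invariant `x`. THEN `torsionLocalKer W E n = torsionLocalKer W E' n`
— the kernel of the tower restriction is inflated from `Γ_E/N ≅ C₂` and vanishes
(`KolyvaginInfResTwo.resKer_eq_bot_of_index_two`). Intended use: `E = ℚ_ℓ`, `E' = K_λ` at an inert
Kolyvagin prime `ℓ` of depth `M+1`, `n = 2^M`, `N = im Γ_{K_λ}` (acting trivially on `E[2^M]`), `τ` a
Frobenius (the regular `C₂`-module, `exists_smul_sub_eq_of_regular`). [cite: SerreGaloisCohomology1997, I.§5.8]
[cite: GrossLMS1991, §9 (local conditions at λ)] [cite: McCallumLMS1991, §3 (3)] -/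
theorem torsionLocalKer_eq_of_index_two (n : ℤ)
    (ι₂ : AlgebraicClosure E →ₐ[E] AlgebraicClosure E')
    (ψ₂ : AddSubgroup.torsionBy (localPoints W E) n →+ AddSubgroup.torsionBy (localPoints W E') n)
    (hψ₂val : ∀ Q : AddSubgroup.torsionBy (localPoints W E) n,
      (ψ₂ Q : localPoints W E') = pointsMapTower W ι₂ (Q : localPoints W E))
    (hψ₂ : ∀ (x : Field.absoluteGaloisGroup E') (Q : AddSubgroup.torsionBy (localPoints W E) n),
      ψ₂ (resGalOfEmb (K := E) ι₂ x • Q) = x • ψ₂ Q)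
    (hbij : Function.Bijective ψ₂)
    (N : Subgroup (Field.absoluteGaloisGroup E)) [N.Normal]
    (hN : IsOpen (N : Set (Field.absoluteGaloisGroup E)))
    (hNθ : N ≤ ((resGalOfEmb (K := E) ι₂ :
      Field.absoluteGaloisGroup E' →ₜ* Field.absoluteGaloisGroup E) :
        Field.absoluteGaloisGroup E' →* Field.absoluteGaloisGroup E).range)
    {τ : Field.absoluteGaloisGroup E} (hτ2 : τ * τ ∈ N)
    (hcov : ∀ g : Field.absoluteGaloisGroup E, g ∈ N ∨ τ⁻¹ * g ∈ N)
    (hsolv : ∀ m : AddSubgroup.torsionBy (localPoints W E) n, (∀ g ∈ N, g • m = m) →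
      m + τ • m = 0 → ∃ x : AddSubgroup.torsionBy (localPoints W E) n,
        (∀ g ∈ N, g • x = x) ∧ τ • x - x = m) :
    W.torsionLocalKer E n = W.torsionLocalKer E' n := by
  exact torsionLocalKer_eq_of_resKer_tower_eq_bot W n ι₂ ψ₂ hψ₂val hψ₂
    (resKer_eq_bot_of_index_two (resGalOfEmb (K := E) ι₂) ψ₂ hψ₂ hbij N hN hNθ hτ2 hcov hsolv)

end Tower

end Summit.BirchSwinnertonDyer.BirchSwinnertonDyer.Theorems.KolyvaginInfResTwo

end
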